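import Literature.MathematicalPhysics.QuantumFieldTheory.Balaban1983to89.B9SupplySockB9P3ZdPer
import Literature.MathematicalPhysics.QuantumFieldTheory.Balaban1983to89.B8LeafModelZd3SockH2Per

/-!
# `Balaban1983to89.B9SupplySockB9P3ZdH2Per` — [Balaban1985RegularSpaces] p. 86 «Theorem 3.3 of [4] implies the bounds (1.59)» ON THE TORUS `T_P` READ ON `ℤᵈ`,
# BOTH-POINTS HÖLDER CURRENCY: THE PERIODIC-GUARDED JUNCTION SOCKET `SockB9P3H2Per` (dag-n05-w1, p644523) AT ONE PERIODIC MEMBER (`Ω 0 = univ`) FROM THE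
# PERIODIC FRAME-FREE BINDERS — `B9SupplySockB9P3ZdPer` (p643074) VERBATIM with the Hölder binder over pairs with BOTH points in `Ω_j` ([4] (3.40)) —
# and the supplier for the genuine torus record `opsAllZdPer` from `InvAtHIPer` + `GlobAtIPer` + `HolderAtIH2Per` alone

statement-level skeleton of published theorems with citation tags; proofs where landed; nothing here is a claim about the
Yang–Mills mass gap

`[Balaban1985RegularSpaces]` ("B8", CMP **99** (1985) 75–102): p. 77 (*«we admit the case when some domains Ω_j are equal to T_η»*), (1.7) p. 77, (1.38)–(1.39)
p. 82 (the Hölder condition «on Ω_j»), (1.40)–(1.42) p. 83, (1.57)–(1.59) p. 86 (*«A = G(U₀)J − G(U₀)(Q*aQA) … Theorem 3.3 of [4] implies the bounds (1.59)»*).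
`[Balaban1985BackgroundPropagators]` ("B9" = "[4]") (3.16) p. 393, (3.20)–(3.22) p. 394, (3.26)–(3.27) p. 395, (3.40) p. 397 (*«The norm |·|_β is the Hölder norm
… on the ξ-lattice»* — both points of the pair in the domain), (3.45), (3.47) p. 398, Thm 3.3 p. 399, (3.69) p. 404, Thm 3.11 p. 416.

CITATION HEADER ∕ WHY THIS FILE (cell `pub-ymgap`, HUMAN RULING D-0062; node N06 = [B9]; seat `pub-ymgap-dag-n06-b` (g23), junction ∕ letter lineage J-N06→N05
and owner of the N06 object layer of the (β′-PERIODIC) road).  TRIGGER: dag-n05-w1 g4's WAKE-line (bus 2026-08-28 15:29Z): «the δ₂∕H2 periodic SUPPLIER —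
`sockB9P3H2Per_opsAllZdPer_of_binders`, i.e. p643074's proof with `HolderAtIPer` over the BOTH-points class — is the one N06 piece the κ-slot's `p3` edge still lacks;
consumer + socket text are in the tree (p645107 · p644523)».  On the (β′-PERIODIC) road under dag-n05-d's P4 ANSWER (ii) the Proposition-3 conjunct of the periodic
display is typed in the δ₂ currency (Hölder line over pairs with BOTH points in `Ω_j`, print's (3.40)) against dag-n05-w1's guarded socket `SockB9P3H2Per`; g22's
supplier `sockB9P3Per_at_univ` ∕ `sockB9P3Per_opsAllZdPer_of_binders` (p643074) concludes the FIRST-POINT socket `SockB9P3Per`.  THIS FILE is the both-points twin: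
the binder `HolderAtIH2Per` (§1), the same [B8] p. 86 chain concluding `SockB9P3H2Per` (§2), and the genuine-record supplier with `PerAtU` ∕ `CurvAtInAk` ∕ `AvgAtP` ∕
`LandauAtUPer` discharged BY NAME from p643074 (§3).  At the torus datum (`Ω_j = ℤᵈ` at every level) the two Hölder classes coincide (§1
`holderAtIH2Per_iff_holderAtIPer_of_univ`), so one Thm-3.3 Hölder witness serves both sockets.

WHAT IS DECLARED ∕ PROVED (kernel, 0 sorry; 1 binder `def` + theorems; no `instance`, no `notation`).
* §1 ★ `HolderAtIH2Per P L ops aT Cβ β len M i m` (= `HolderAtIPer` with the class `q.2.2 ∈ AdmPair ∧ q.2.2.1 ∈ Ω_j ∧ q.2.2.2 ∈ Ω_j`), `holderAtIH2Per_anti`,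
  ★ `holderAtIH2Per_iff_holderAtIPer_of_univ` (`∀ j, i.Ω j = univ` ⟹ the two binders are equivalent).
* §2 ★★★ `sockB9P3H2Per_at_univ` — at a member with `i.Ω 0 = univ` (`2 ≤ d`, `1 ≤ L`, `1 ≤ M`, `P ≠ 0`): `InvAtHIPer` + `CurvAtInAk` + `LandauAtUPer` + `AvgAtP … i.Λb`
  + `GlobAtIPer` + `HolderAtIH2Per` + `PerAtU` (+ signs) ⟹ `SockB9P3H2Per P L (max 1 (2B₀ max 1 q)) (2 (max 0 Cβ) max 1 q) (min (1∕16) (min aI (min aT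
  (1∕(2B₀c₆₉M+1))))) β len i.η m i.Ω i.Λs i.Λb` (p643074's proof verbatim; only line 5's class changes).
* §3 ★★ `sockB9P3H2Per_opsAllZdPer_of_binders` — the both-points socket for `opsAllZdPer τ L P i.Λb ops₀` at a member with `i.Ω 0 = univ`, `Lᵐ ∣ P`, periodic class
  sections and `LevelSepPP0`, from `InvAtHIPer` + `GlobAtIPer` + `HolderAtIH2Per` ALONE.

HONEST SCOPE.  (i) Bookkeeping of [B8] p. 86 with displayed binders; NO estimate of [B9] is proved: `GlobAtIPer` ∕ `HolderAtIH2Per` (Thm 3.3 on the torus) and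
`InvAtHIPer` (Thm 3.11; its flat inhabitant for the genuine record is this seat's `B9Thm311FlatPositivityZdPer`, the curved neighbourhood dag-n06-w4's road) are
hypotheses of the final theorem; member-UNIFORM constants are N06's node content.  (ii) Members with `Ω 0 = univ` only.  (iii) Count-neutral; N05 ∕ N06 NOT
discharged; K1⁹ `stmt-QuantumFields-27364` NOT closed; counts UNMOVED; one finite `𝕋⁴` programme at fixed `ε`, Bałaban as printed; R4 closes only the conditional
finite-`𝕋⁴` rung `BalabanLadder.UV` — nothing continuum ∕ ℝ⁴ ∕ OS ∕ mass gap ∕ Clay.  Unit `pub-ymgap-dag-n06-b` (g23), 2026-08-28; NEW file importing p643074 and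
p644523; modifies nothing.  Net new unproved facts: 0 (one displayed binder `def` with body).
-/

noncomputable section

namespace Literature.MathematicalPhysics.QuantumFieldTheory.Balaban1983to89.B9SupplySockB9P3ZdH2Per


open B7Prop1Explicit B7Prop2Explicit
open B7Prop1Local (InBox loK bondHiK)
open B7Prop4GeneralLevels (linCovIter)
open B8Ineq132 (covDerivFwd covDeriv InAk BondTouches)
open B8Eq184Proof (cfgExp)
open B8Lemma1NonAbelian (mulCfg)
open B8Eq140Level (SideTouches)
open B8Eq146AExpansion (iEta plaqCovDeriv)
open B8Eq143PlaqExpansion (pdiv)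
open B8Eq155JBound (Jcur wsup)
open B8ScaledSupNorm (bondNorm msup weight Bdd)
open B8Eq138LandauZd (IsLandau138 IsLandau138W covLap)
open B8LeafModelZd (ZdIdx)
open B8LeafModelZd3SockPer (SockB9P3Per)
open B8LeafModelZd3SockH2Per (SockB9P3H2Per)
open B9Eq340HolderZd (hquot AdmPair)
open B9SupplySockB9P3ZdLetters (OpsZd deltaAOf)
open B9SupplySockB9P3ZdLettersOmega (OnDom)
open B9SupplySockB9P3Zd (landau_of_landauW norm_Jcur_le_of_grad bdd_neg_three_of_pointwise apriori_arith)
open B9SupplySockB9P3ZdGammaInAk (CurvAtInAk)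
open B9SupplySockB9P3ZdGammaInAkDpZd (withDpZd curvAtInAk_of_Dp_eq)
open B9SupplySockB9P3ZdGammaUniv (AvgAtP)
open B9SupplySockB9P3ZdDatum (LandauAtU GlobAtI)
open B9Eq316AveragingTransposeZd (betaTau qQ)
open B9Eq316AveragingTransposeZdPrinted (withQQP)
open B9Eq316AveragingTransposeZdLevelZero (LevelSepPP0 avgAtP_withQQP₀)
open B9Eq327GreenZdHermPer (domSubHPer PerPreservingAt InvAtHIPer bondTouches_univ)
open B9SupplySockB9P3ZdAllLettersZdPer (opsAllZdPer opsAllZdPer_DRDs perPreservingAt_opsAllZdPer)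
open T4TermwiseTorus (IsPeriodic)

-- `Site` alone could resolve to the torus sites of `Setup.lean`; re-export the `ℤ^d` sites of `B7Prop1Explicit`.
export B7Prop1Explicit (Site)
open B9SupplySockB9P3ZdPer (LandauAtUPer GlobAtIPer HolderAtIPer PerAtU perAtU_opsAllZdPer curvAtInAk_opsAllZdPer avgAtP_opsAllZdPer₀ landauAtUPer_opsAllZdPer)

variable {d : ℕ} {𝔸 : Type*} [CStarAlgebra 𝔸]

/-! ## §1  The both-points Hölder binder on the torus -/

section Binders

variable (P L : ℕ)

/-- ★ **THE HÖLDER ENTRY (3.45) ∕ (1.59)₅ OF `G(U₀)` ON THE TORUS, BOTH POINTS OF THE PAIR IN `Ω_j`** — `B9SupplySockB9P3ZdPer.HolderAtIPer` VERBATIM except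
that the weighted Hölder supremum runs over the admissible pairs `(x, x′)` with `x ∈ Ω_j` AND `x′ ∈ Ω_j` ([4] (3.40): the seminorm of a function on the domain;
the class of this lineage's edition δ₂ `B9SupplySockB9P3ZdGammaUnivDelta2.HolderAtδ2` and of dag-n05-w1's socket `SockB9P3H2Per`): for every `α₀ ≤ aT`, every
periodic unitary `U₀ ∈ 𝔄_m({Ω_j}, α₀)` and every periodic Hermitian `J`, `sup (Lʲη)^{2+β}·hquot ≤ C_β·|J|₍₋₃₎`.  A `Prop` on the record (Thm 3.3's Hölder member on
the torus). [cite: Balaban1985BackgroundPropagators, (3.45) p.398, (3.40) p.397, Thm 3.3 p.399; Balaban1985RegularSpaces, (1.59) p.86, (1.39) p.82, (1.7) p.77, p.77 («Ω_j = T_η»)] -/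
def HolderAtIH2Per (ops : ℝ → ZdIdx d L → ℕ → OpsZd d 𝔸) (aT Cβ β : ℝ) (len : Site d → ℝ) (M : ℝ) (i : ZdIdx d L) (m : ℕ) : Prop :=
  ∀ (α₀ : ℝ) (U₀ : Site d → Fin d → 𝔸ˣ), (∀ x κ, U₀ x κ ∈ unitaryUnits 𝔸) → IsPeriodic P U₀ → 0 < α₀ → α₀ ≤ aT → InAk L m i.η α₀ i.Ω U₀ →
    ∀ J : Site d → Fin d → 𝔸, J ∈ domSubHPer (d := d) (𝔸 := 𝔸) P →
      msup L m i.η (-(2 + β)) (fun j (q : Fin d × Fin d × (Site d × Site d)) => q.2.2 ∈ AdmPair i.η len ∧ q.2.2.1 ∈ i.Ω j ∧ q.2.2.2 ∈ i.Ω j)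
          (fun q => hquot i.η β len U₀ (covDerivFwd i.η U₀ q.1 (fun z => (ops M i m).Gop U₀ J z q.2.1)) q.2.2) ≤
        Cβ * bondNorm L m i.η (-(3 : ℝ)) i.Ω J

/-- `HolderAtIH2Per` is antitone in `aT` and monotone in `C_β`. [cite: Balaban1985BackgroundPropagators, (3.45) p.398 (bookkeeping)] -/
theorem holderAtIH2Per_anti {ops : ℝ → ZdIdx d L → ℕ → OpsZd d 𝔸} {aT aT' Cβ Cβ' β : ℝ} {len : Site d → ℝ} (ha : aT' ≤ aT) (hC : Cβ ≤ Cβ')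
    {M : ℝ} {i : ZdIdx d L} {m : ℕ} (h : HolderAtIH2Per P L ops aT Cβ β len M i m) : HolderAtIH2Per P L ops aT' Cβ' β len M i m := by
  intro α₀ U₀ hU₀ hper hα hαT hIn J hJ
  exact (h α₀ U₀ hU₀ hper hα (hαT.trans ha) hIn J hJ).trans
    (mul_le_mul_of_nonneg_right hC (B8ScaledSupNorm.msup_nonneg L m i.hη.le _ _ _))

/-- ★ **AT A MEMBER WITH `Ω_j = ℤᵈ` AT EVERY LEVEL THE TWO HÖLDER CLASSES COINCIDE**: «first point in `Ω_j`» and «both points in `Ω_j`» are the same predicate, so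
`HolderAtIPer ↔ HolderAtIH2Per` there (the torus datum of [B8] p. 77; lit-balaban's `torusIdx`). [cite: Balaban1985RegularSpaces, p.77 («Ω_j = T_η»), (1.39) p.82; Balaban1985BackgroundPropagators, (3.40) p.397] -/
theorem holderAtIH2Per_iff_holderAtIPer_of_univ {ops : ℝ → ZdIdx d L → ℕ → OpsZd d 𝔸} {aT Cβ β : ℝ} {len : Site d → ℝ} {M : ℝ} {i : ZdIdx d L}
    (hΩ : ∀ j, i.Ω j = Set.univ) {m : ℕ} : HolderAtIH2Per P L ops aT Cβ β len M i m ↔ HolderAtIPer P L ops aT Cβ β len M i m := by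
  have hcls : (fun j (q : Fin d × Fin d × (Site d × Site d)) => q.2.2 ∈ AdmPair i.η len ∧ q.2.2.1 ∈ i.Ω j ∧ q.2.2.2 ∈ i.Ω j) =
      (fun j (q : Fin d × Fin d × (Site d × Site d)) => q.2.2 ∈ AdmPair i.η len ∧ q.2.2.1 ∈ i.Ω j) := by
    funext j q
    simp only [hΩ j, Set.mem_univ, and_true]
  unfold HolderAtIH2Per HolderAtIPer
  rw [hcls]

end Binders

/-! ## §2  The supplier of the both-points socket: [B8] p. 86's chain at a periodic member -/

section Supply

variable [Nontrivial 𝔸] (P L : ℕ) (ops : ℝ → ZdIdx d L → ℕ → OpsZd d 𝔸)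

/-- ★★★ **THE PERIODIC-GUARDED BOTH-POINTS SOCKET AT ONE PERIODIC MEMBER FROM THE PERIODIC BINDERS** — `B9SupplySockB9P3ZdPer.sockB9P3Per_at_univ` VERBATIM
with the Hölder binder `HolderAtIH2Per` (both points in `Ω_j`) and the conclusion dag-n05-w1's `SockB9P3H2Per P L B₀′ B₀β′ cP β len i.η m i.Ω i.Λs i.Λb` (the δ₂ currency
of the (β′-PERIODIC) road under P4 (ii)); same constants `B₀′ = max{1, 2B₀max{1,q}}`, `B₀β′ = 2·max{0,C_β}·max{1,q}`, `cP = min{1∕16, aI, aT, 1∕(2B₀c₆₉M+1)}`,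
same chain ([B8] p. 86: `A′ = G(U₀)J̃`, `|J̃|₍₋₃₎ ≤ |J|₍₋₃₎ + c₆₉Mα₀|A′|₍₋₁₎ + q|B₁|`, a-priori step with `θ ≤ ½`). [cite: Balaban1985RegularSpaces, (1.58)–(1.59) p.86, Prop. 3 p.87, (1.38)–(1.39) p.82, (1.42) p.83, p.77 («Ω_j = T_η»); Balaban1985BackgroundPropagators, Thm 3.3 p.399, (3.26)–(3.27) p.395, (3.40) p.397, (3.45), (3.47) p.398, (3.69) p.404, (3.16) p.393, (3.20)–(3.21) p.394] -/
theorem sockB9P3H2Per_at_univ [NeZero P] (hd2 : 2 ≤ d) (hL : 1 ≤ L) {c69 q aI aT B₀ Cβ β : ℝ} {len : Site d → ℝ}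
    {M : ℝ} (hM1 : 1 ≤ M) (i : ZdIdx d L) (hΩ : i.Ω 0 = Set.univ) {m : ℕ}
    (hinv : InvAtHIPer P L ops aI M i m) (hcurv : CurvAtInAk L ops c69 M i m) (hlan : LandauAtUPer P L ops M i m)
    (havg : AvgAtP L ops q i.Λb M i m) (hglob : GlobAtIPer P L ops aT B₀ M i m) (hhol : HolderAtIH2Per P L ops aT Cβ β len M i m)
    (hper : PerAtU P L ops M i m) (hc69 : 0 ≤ c69) (hq : 0 ≤ q) (hB₀ : 0 < B₀) :
    SockB9P3H2Per (𝔸 := 𝔸) P L (max 1 (2 * B₀ * max 1 q)) (2 * max 0 Cβ * max 1 q)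
      (min (1 / 16) (min aI (min aT (1 / (2 * B₀ * c69 * M + 1))))) β len i.η m i.Ω i.Λs i.Λb := by
  intro α₀ α₂ hα₀ hα₀c hα₂ hα₂c U₀ W hU₀ hWu hU₀p _ hInA _ hLanW A' hsa hA'p h41 hA0
  -- the thresholds
  have hη : 0 < i.η := i.hη
  have hLr : (1 : ℝ) ≤ L := by exact_mod_cast hL
  have hM0 : 0 < M := lt_of_lt_of_le one_pos hM1
  simp only [le_min_iff] at hα₀c hα₂c
  obtain ⟨-, hα₀I, hα₀T, hα₀θ⟩ := hα₀c
  obtain ⟨hα₂16, -, -, -⟩ := hα₂c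
  have hκ' : 0 ≤ c69 * M * α₀ := by positivity
  have hθ : B₀ * (c69 * M * α₀) ≤ 1 / 2 := by
    have hpos : 0 < 2 * B₀ * c69 * M + 1 := by positivity
    have h1 : α₀ * (2 * B₀ * c69 * M + 1) ≤ 1 := (le_div_iff₀ hpos).1 hα₀θ
    nlinarith [hα₀.le, hB₀.le, hκ']
  have hU₀1 : ∀ x κ, U₀ x κ ∈ U1 𝔸 := fun x κ => unitaryUnits_le_U1 (hU₀ x κ)
  -- every bond touches `Ω₀ = ℤᵈ`
  have hb0 : ∀ (y : Site d) (τ : Fin d), BondTouches (i.Ω 0) y τ := fun y τ => by rw [hΩ]; exact bondTouches_univ y τ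
  -- A′ is a field of the class E(Ω₀), periodic and Hermitian
  have hAbd : Bdd L m i.η (-(1 : ℝ)) (fun j (b : Site d × Fin d) => SideTouches (i.Ω j) b.1 b.2) (fun b => A' b.1 b.2) := by
    have e1 : (-(1 : ℝ)) = -((1 : ℕ) : ℝ) := by norm_num
    rw [e1]
    refine B8ScaledSupNorm.bdd_of_forall (c := α₂) fun j hj b hb => ?_
    rw [B8ScaledSupNorm.weight_neg_natCast, pow_one]
    have h := (h41 j hj b.1 b.2 hb).2
    have hs : 0 < (L : ℝ) ^ j * i.η := B8ScaledSupNorm.scale_pos hL hη j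
    calc (L : ℝ) ^ j * i.η * ‖A' b.1 b.2‖ ≤ (L : ℝ) ^ j * i.η * (α₂ * ((L : ℝ) ^ j * i.η)⁻¹) :=
          mul_le_mul_of_nonneg_left h hs.le
      _ = α₂ := by rw [mul_comm α₂, ← mul_assoc, mul_inv_cancel₀ hs.ne', one_mul]
  have hOn : OnDom L m i.η i.Ω A' := ⟨fun y τ h => absurd (hb0 y τ) h, hAbd⟩
  obtain ⟨a, ha_def⟩ : ∃ a : ℝ,
      a = msup L m i.η (-(1 : ℝ)) (fun j (b : Site d × Fin d) => SideTouches (i.Ω j) b.1 b.2) (fun b => A' b.1 b.2) :=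
    ⟨_, rfl⟩
  have ha0 : 0 ≤ a := by rw [ha_def]; exact B8ScaledSupNorm.msup_nonneg L m hη.le _ _ _
  -- the Landau condition for A′; the source J̃ = Δ_a(U₀)A′ and A′ = G(U₀)J̃ ((1.58))
  have hLanA : IsLandau138 L m i.η (i.Ω 0) (i.Λs m) U₀ A' := landau_of_landauW hd2 hη U₀ hWu hα₂16 h41 hLanW
  obtain ⟨Jt, hJt_def⟩ : ∃ Jt : Site d → Fin d → 𝔸, Jt = deltaAOf i.η (ops M i m) U₀ A' := ⟨_, rfl⟩
  have hJtper : Jt ∈ domSubHPer (d := d) (𝔸 := 𝔸) P := by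
    rw [hJt_def]; exact hper U₀ hU₀ hU₀p A' ⟨hA'p, hsa⟩
  have hGJ : (ops M i m).Gop U₀ Jt = A' := by
    rw [hJt_def]; exact hinv α₀ U₀ hU₀ hU₀p hα₀I hInA A' hA'p hOn hsa _ fun y τ _ => rfl
  have hDRD : ∀ (x : Site d) (μ : Fin d), (ops M i m).DRDs U₀ A' x μ = 0 := hlan U₀ hU₀ hU₀p A' hA'p hOn hLanA
  have hJtb : ∀ (x : Site d) (μ : Fin d),
      Jt x μ = Jcur i.η U₀ A' μ x + (ops M i m).Dp U₀ A' x μ + (ops M i m).DRDs U₀ A' x μ + (ops M i m).QQ U₀ A' x μ := by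
    intro x μ; rw [hJt_def]; rfl
  -- the right-hand side of the socket: |J|₍₋₃₎ and |B₁|
  obtain ⟨nJ, hnJ_def⟩ : ∃ nJ : ℝ, nJ = bondNorm L m i.η (-(3 : ℝ)) i.Ω (fun x μ => Jcur i.η U₀ A' μ x) := ⟨_, rfl⟩
  obtain ⟨nB, hnB_def⟩ : ∃ nB : ℝ, nB = wsup 1 (fun p : {p : ℕ × (Site d × Fin d) // p.1 ≤ m ∧ p.2 ∈ i.Λb m p.1} =>
      linCovIter L U₀ (iEta i.η A') p.1.1 p.1.2.1 p.1.2.2) := ⟨_, rfl⟩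
  have hnJ0 : 0 ≤ nJ := by rw [hnJ_def]; exact B8ScaledSupNorm.msup_nonneg L m hη.le _ _ _
  have hnB0 : 0 ≤ nB := by rw [hnB_def]; exact B8Eq155JBound.wsup_nonneg zero_le_one _
  -- J is bounded (A′ is): the real supremum |J|₍₋₃₎ is attained
  have hAglob : ∀ (y : Site d) (τ : Fin d), ‖A' y τ‖ ≤ α₂ * i.η⁻¹ := by
    intro y τ
    by_cases hmem : ∃ j, j ≤ m ∧ SideTouches (i.Ω j) y τ
    · obtain ⟨j, hj, hs⟩ := hmem
      have hLj : (1 : ℝ) ≤ (L : ℝ) ^ j := one_le_pow₀ hLr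
      calc ‖A' y τ‖ ≤ α₂ * ((L : ℝ) ^ j * i.η)⁻¹ := (h41 j hj y τ hs).2
        _ = α₂ * i.η⁻¹ * ((L : ℝ) ^ j)⁻¹ := by rw [mul_inv]; ring
        _ ≤ α₂ * i.η⁻¹ * 1 := by
            apply mul_le_mul_of_nonneg_left (inv_le_one_of_one_le₀ hLj) (by positivity)
        _ = α₂ * i.η⁻¹ := mul_one _
    · rw [hA0 y τ fun j hj hs => hmem ⟨j, hj, hs⟩, norm_zero]
      positivity
  have hgrad : ∀ (y : Site d) (κ τ : Fin d), ‖covDerivFwd i.η U₀ κ (fun z => A' z τ) y‖ ≤ 2 * α₂ * i.η⁻¹ * i.η⁻¹ := by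
    intro y κ τ
    unfold covDerivFwd
    rw [norm_smul, norm_inv, Real.norm_eq_abs, abs_of_pos hη]
    have h1 : ‖B7Eq78Linearization.conjR (U₀ y κ) (A' (y + e κ) τ) - A' y τ‖ ≤ α₂ * i.η⁻¹ + α₂ * i.η⁻¹ := by
      calc ‖B7Eq78Linearization.conjR (U₀ y κ) (A' (y + e κ) τ) - A' y τ‖
          ≤ ‖B7Eq78Linearization.conjR (U₀ y κ) (A' (y + e κ) τ)‖ + ‖A' y τ‖ := norm_sub_le _ _
        _ ≤ α₂ * i.η⁻¹ + α₂ * i.η⁻¹ := by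
            rw [B8Ineq132.norm_conjR (hU₀1 y κ)]
            exact add_le_add (hAglob _ _) (hAglob _ _)
    calc i.η⁻¹ * ‖B7Eq78Linearization.conjR (U₀ y κ) (A' (y + e κ) τ) - A' y τ‖
        ≤ i.η⁻¹ * (α₂ * i.η⁻¹ + α₂ * i.η⁻¹) := mul_le_mul_of_nonneg_left h1 (by positivity)
      _ = 2 * α₂ * i.η⁻¹ * i.η⁻¹ := by ring
  have hJbd : Bdd L m i.η (-(3 : ℝ)) (fun j (b : Site d × Fin d) => BondTouches (i.Ω j) b.1 b.2)
      (fun b => Jcur i.η U₀ A' b.2 b.1) :=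
    bdd_neg_three_of_pointwise hL hη fun b => norm_Jcur_le_of_grad hη hU₀1 hgrad b.2 b.1
  -- |J̃|₍₋₃₎ ≤ |J|₍₋₃₎ + c₆₉ M α₀ |A′|₍₋₁₎ + q |B₁| (pointwise: (3.26) with (3.69), the Landau condition, (3.16))
  have hJt : bondNorm L m i.η (-(3 : ℝ)) i.Ω Jt ≤ nJ + c69 * M * α₀ * a + q * nB := by
    have e3 : (-(3 : ℝ)) = -((3 : ℕ) : ℝ) := by norm_num
    refine B8ScaledSupNorm.msup_le (by positivity) fun j hj b hb => ?_
    have hw : weight L i.η (-(3 : ℝ)) j = ((L : ℝ) ^ j * i.η) ^ 3 := by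
      rw [e3, B8ScaledSupNorm.weight_neg_natCast]
    have hw0 : 0 ≤ ((L : ℝ) ^ j * i.η) ^ 3 := by positivity
    have h1 : weight L i.η (-(3 : ℝ)) j * ‖Jcur i.η U₀ A' b.2 b.1‖ ≤ nJ := by
      rw [hnJ_def]; exact B8ScaledSupNorm.weight_mul_norm_le_msup hJbd hj hb
    have h2 : ((L : ℝ) ^ j * i.η) ^ 3 * ‖(ops M i m).Dp U₀ A' b.1 b.2‖ ≤ c69 * M * α₀ * a := by
      rw [ha_def]; exact hcurv α₀ U₀ hU₀ hα₀ hInA A' hOn j hj b.1 b.2 hb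
    have h4 : ((L : ℝ) ^ j * i.η) ^ 3 * ‖(ops M i m).QQ U₀ A' b.1 b.2‖ ≤ q * nB := by
      rw [hnB_def]; exact havg U₀ hU₀ A' hOn j hj b.1 b.2 hb
    have hsum : ‖Jt b.1 b.2‖ ≤
        ‖Jcur i.η U₀ A' b.2 b.1‖ + ‖(ops M i m).Dp U₀ A' b.1 b.2‖ + ‖(ops M i m).QQ U₀ A' b.1 b.2‖ := by
      rw [hJtb, hDRD b.1 b.2, add_zero]
      exact norm_add₃_le
    rw [hw] at h1 ⊢
    calc ((L : ℝ) ^ j * i.η) ^ 3 * ‖Jt b.1 b.2‖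
        ≤ ((L : ℝ) ^ j * i.η) ^ 3 *
            (‖Jcur i.η U₀ A' b.2 b.1‖ + ‖(ops M i m).Dp U₀ A' b.1 b.2‖ + ‖(ops M i m).QQ U₀ A' b.1 b.2‖) :=
          mul_le_mul_of_nonneg_left hsum hw0
      _ = ((L : ℝ) ^ j * i.η) ^ 3 * ‖Jcur i.η U₀ A' b.2 b.1‖ + ((L : ℝ) ^ j * i.η) ^ 3 * ‖(ops M i m).Dp U₀ A' b.1 b.2‖ +
            ((L : ℝ) ^ j * i.η) ^ 3 * ‖(ops M i m).QQ U₀ A' b.1 b.2‖ := by ring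
      _ ≤ nJ + c69 * M * α₀ * a + q * nB := add_le_add (add_le_add h1 h2) h4
  -- Theorem 3.3's γ = −3 entries at J̃ ((3.47) ⇒ (1.59) lines 1, 2, 4), and the Hölder entry (line 5)
  obtain ⟨hG0, hG1, hG3⟩ := hglob α₀ U₀ hU₀ hU₀p hα₀ hα₀T hInA Jt hJtper
  rw [hGJ] at hG0 hG1 hG3
  have hline1 : a ≤ B₀ * bondNorm L m i.η (-(3 : ℝ)) i.Ω Jt := by rw [ha_def]; exact hG0
  have hline5 : msup L m i.η (-(2 + β))
      (fun j (q : Fin d × Fin d × (Site d × Site d)) => q.2.2 ∈ AdmPair i.η len ∧ q.2.2.1 ∈ i.Ω j ∧ q.2.2.2 ∈ i.Ω j)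
      (fun q => hquot i.η β len U₀ (covDerivFwd i.η U₀ q.1 (fun z => A' z q.2.1)) q.2.2) ≤
      max 0 Cβ * bondNorm L m i.η (-(3 : ℝ)) i.Ω Jt := by
    have h := hhol α₀ U₀ hU₀ hU₀p hα₀ hα₀T hInA Jt hJtper
    rw [hGJ] at h
    exact h.trans (mul_le_mul_of_nonneg_right (le_max_right _ _) (B8ScaledSupNorm.msup_nonneg L m hη.le _ _ _))
  -- the a-priori (Neumann) step, in the concrete norms
  have hJJ : bondNorm L m i.η (-(3 : ℝ)) i.Ω (fun x μ => pdiv i.η U₀ (plaqCovDeriv i.η U₀ A') μ x) = nJ := by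
    rw [hnJ_def]; rfl
  rw [← ha_def, ← hnJ_def, ← hnB_def]
  exact apriori_arith hB₀ hq hκ' hθ ha0 hnJ0 hnB0 (le_max_left 0 _) hJJ hJt hline1 hG1 hG3 hline5

end Supply

/-! ## §3  The genuine torus record: the both-points socket from `InvAtHIPer` + `GlobAtIPer` + `HolderAtIH2Per` alone -/

section Genuine

variable (L : ℕ) (τ : 𝔸 →ₗ[ℂ] ℂ) (P : ℕ) [Nontrivial 𝔸] [FiniteDimensional ℝ 𝔸] [NeZero P]

/-- ★★ **THE BOTH-POINTS PERIODIC SOCKET FOR THE GENUINE TORUS RECORD AT ITS OWN LAW CLASS, FROM THE THREE ANALYTIC BINDERS ALONE** —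
`B9SupplySockB9P3ZdPer.sockB9P3Per_opsAllZdPer_of_binders` VERBATIM with `HolderAtIH2Per` and the conclusion `SockB9P3H2Per` (n05-w1's `p3` edge under P4 (ii)+κ):
at a member `(M, i, m)` with `i.Ω 0 = univ`, `2 ≤ d`, `2 ≤ L`, `1 ≤ M`, `P ≠ 0`, faithful Hermitian tracial `τ` with `C_τ`, `Lᵐ ∣ P`, periodic class sections and
EDITION P₀'s law `LevelSepPP0 L m i.Ω i.Λb s`: `InvAtHIPer` + `GlobAtIPer` + `HolderAtIH2Per` for `opsAllZdPer τ L P i.Λb ops₀` ⟹ `SockB9P3H2Per P L B₀′ B₀β′ cP β len i.η m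
i.Ω i.Λs i.Λb` (`PerAtU`, `CurvAtInAk`, `AvgAtP`, `LandauAtUPer` discharged by name from p643074). [cite: Balaban1985RegularSpaces, (1.58)–(1.59) p.86, Prop. 3 p.87, (1.39) p.82, p.77 («Ω_j = T_η»); Balaban1985BackgroundPropagators, Thm 3.3 p.399, Thm 3.11 p.416, (3.26)–(3.27) p.395, (3.40) p.397, (3.69) p.404, (3.16) p.393, (3.20)–(3.22) p.394] -/
theorem sockB9P3H2Per_opsAllZdPer_of_binders (hd2 : 2 ≤ d) (hL : 2 ≤ L) (hτp : ∀ a : 𝔸, a ≠ 0 → 0 < (τ (star a * a)).re)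
    (hτt : ∀ a b : 𝔸, τ (a * b) = τ (b * a)) (hτs : ∀ a : 𝔸, τ (star a) = starRingEnd ℂ (τ a))
    {Cτ : ℝ} (hCτ : ∀ x y : 𝔸, |(τ (star x * y)).re| ≤ Cτ * ‖x‖ * ‖y‖)
    (ops₀ : ℝ → ZdIdx d L → ℕ → OpsZd d 𝔸) {M : ℝ} (hM1 : 1 ≤ M) (i : ZdIdx d L) (hΩ : i.Ω 0 = Set.univ) {m s : ℕ} (hdvd : L ^ m ∣ P)
    (hΛ : ∀ j, j ≤ m → ∀ κ : Fin d, IsPeriodic (P / L ^ j) (fun z => (z, κ) ∈ i.Λb m j)) (hlaw : LevelSepPP0 L m i.Ω i.Λb s)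
    {aI aT B₀ Cβ β : ℝ} {len : Site d → ℝ}
    (hinv : InvAtHIPer P L (opsAllZdPer τ L P i.Λb ops₀) aI M i m)
    (hglob : GlobAtIPer P L (opsAllZdPer τ L P i.Λb ops₀) aT B₀ M i m) (hhol : HolderAtIH2Per P L (opsAllZdPer τ L P i.Λb ops₀) aT Cβ β len M i m)
    (hB₀ : 0 < B₀) :
    SockB9P3H2Per (𝔸 := 𝔸) P L (max 1 (2 * B₀ * max 1 (qQ d L Cτ (betaTau τ) s))) (2 * max 0 Cβ * max 1 (qQ d L Cτ (betaTau τ) s))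
      (min (1 / 16) (min aI (min aT (1 / (2 * B₀ * (14 * ((d - 1 : ℕ) : ℝ)) * M + 1))))) β len i.η m i.Ω i.Λs i.Λb := by
  have hL1 : 1 ≤ L := le_trans (by norm_num) hL
  have hbox : ∀ j, 1 ≤ j → j ≤ m → ∀ c ∈ i.Λb m j, ∀ x, InBox (loK L j c.1) (bondHiK L j c.1 c.2) x → x ∈ i.Ω (j - 1) :=
    fun j hj1 hj c hc x hx => (hlaw j hj c hc x hx).1 hj1
  have hq : 0 ≤ qQ d L Cτ (betaTau τ) s := by
    have hCτ0 : 0 ≤ Cτ := by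
      have h := hCτ 1 1
      rw [star_one, one_mul, norm_one, mul_one, mul_one] at h
      exact le_trans (abs_nonneg _) h
    have hβ : 0 ≤ betaTau τ := by
      unfold betaTau
      split_ifs
      · exact Finset.sum_nonneg fun i _ => mul_nonneg (norm_nonneg _) (norm_nonneg _)
      · exact le_rfl
    have hα : 0 ≤ B9Eq316AveragingTransposeZd.alphaQ d L := (B9Eq316AveragingTransposeZd.alphaQ_pos d hL1).le
    have hθ : 0 ≤ B7Prop5GeneralLevels.thetaGen d L (B9Eq316AveragingTransposeZd.alphaQ d L) := by
      unfold B7Prop5GeneralLevels.thetaGen; positivity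
    unfold qQ; positivity
  haveI : NeZero L := ⟨by omega⟩
  exact sockB9P3H2Per_at_univ P L (opsAllZdPer τ L P i.Λb ops₀) hd2 hL1 hM1 i hΩ hinv (curvAtInAk_opsAllZdPer L τ P hL1 i.Λb ops₀ hM1 i m)
    (landauAtUPer_opsAllZdPer L τ P hτp hτt hτs i.Λb ops₀ M i hΩ hdvd)
    (avgAtP_opsAllZdPer₀ L τ P hd2 hL hCτ i.Λb ops₀ M i m hlaw) hglob hhol
    (perAtU_opsAllZdPer L τ P hL hτp hτt hτs i.Λb ops₀ M i hdvd hΛ hbox) (by positivity) hq hB₀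

end Genuine

end Literature.MathematicalPhysics.QuantumFieldTheory.Balaban1983to89.B9SupplySockB9P3ZdH2Per

end
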